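import Mathlib
import HarnessLib
import Summits.QuantumFields.YangMills.Theorems.MirrorModularBoostsHypercubicLimitPlaneDistDisjointProductBound
import Summits.QuantumFields.YangMills.Theorems.MirrorModularBoostsHypercubicLimitDisjointLocalisedBound
import Summits.QuantumFields.YangMills.Theorems.MirrorModularBoostsHypercubicLimitSeparatedScaleBound
import Summits.QuantumFields.YangMills.Theorems.MirrorModularBoostsHypercubicLimitFlatShellDecomposition
import Summits.QuantumFields.YangMills.Theorems.LangevinControlUVOSLegsAtWeakCouplingCStubLocalityFlatApprox

/-!
# Line `Sketch` (coupling response), step Z1 at fixed degree: smeared moment bounds ⇒ functional bounds on `⁰𝒮ₙ`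

Crux `stmt-QuantumFields-16154` (`HypercubicLimit`), line `Sketch`, reshape 8.  The model-free extension theorem
`offDiagonal_bound_of_disjointProductBound`: a continuous linear functional `T` on `𝓢((ℝ⁴)ⁿ, ℂ)` which is bounded by
`M ∏ᵢ |φᵢ|_s` on tensor products of one-point tests with PAIRWISE DISJOINT supports is bounded on `⁰𝒮ₙ` (tests vanishing to
infinite order on the coincidence locus) by `M · C(n,s) · |F|_{t(n,s)}`.  Assembly of the three landed pieces — localisation by
slot-disjoint cutoffs + Summers' E0″ ⇒ E0′ engine (`disjointLocalisedBound`), the single-scale lattice partition for separated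
tests (`separatedScaleBound`), the flat dyadic shells near the locus (`flatShellDecomposition`) — with the density of compactly
supported separated tests in `⁰𝒮` (`exists_separated_tendsto_of_isOffDiagonal`) and continuity.  With the model-side bound
`planeDist_disjointProductBound` this gives **`uniformFunctionalBoundPlanes_fixedDegree`**: along a scheme with
`UniformMomentBoundsPlanes`, for every degree `n` the renormalised plane-string distributions `planeDist r sch k n q` are bounded
on `⁰𝒮ₙ`, UNIFORMLY in the step `k` and the string `q`, by one Schwartz norm.  (The registered Z1 `stub_functionalBoundPlanes` asks in
addition for the factorial dependence `α (n!)^β |F|_{n s}` of the constants on the degree — OS's E0′ currency; that bookkeeping is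
the remaining part of Z1.)

Refs: OsterwalderSchrader1975 §IV.1 and Appendix (Summers); GlimmJaffe1987 §19.1.
-/

noncomputable section

open scoped SchwartzMap
open MeasureTheory Filter Topology
open Literature.MathematicalPhysics.AQFT Literature.MathematicalPhysics.QuantumLattice
open Literature.MathematicalPhysics.QuantumFieldTheory

namespace Summit.QuantumFields.YangMills.Cruxes.HypercubicLimit.CouplingResponse

/-- **From disjoint-product bounds to bounds on `⁰𝒮ₙ` (fixed degree).**  For every `n, s` there are `t, C ≥ 0` such that every
continuous linear functional `T` on `𝓢((ℝ⁴)ⁿ, ℂ)` with `‖T(φ₁ ⊗ ⋯ ⊗ φₙ)‖ ≤ M ∏ᵢ |φᵢ|_s` for one-point tests with pairwise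
disjoint supports satisfies `‖T F‖ ≤ M C |F|_t` for all `F ∈ ⁰𝒮ₙ`.  Pieces B, C, D + density + continuity.
[cite: OsterwalderSchraderCMP1975, Appendix (S. Summers)] -/
theorem offDiagonal_bound_of_disjointProductBound (n s : ℕ) :
    ∃ (t : ℕ) (C : ℝ), 0 ≤ C ∧ ∀ (T : 𝓢((Fin n → EuclideanSpace ℝ (Fin 4)), ℂ) →L[ℂ] ℂ) (M : ℝ), 0 ≤ M →
      (∀ (φ : Fin n → 𝓢(EuclideanSpace ℝ (Fin 4), ℂ)),
        (∀ i j, i ≠ j → Disjoint (tsupport (φ i : EuclideanSpace ℝ (Fin 4) → ℂ)) (tsupport (φ j : EuclideanSpace ℝ (Fin 4) → ℂ))) →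
        ∀ F : 𝓢((Fin n → EuclideanSpace ℝ (Fin 4)), ℂ), IsTensorOf F φ → ‖T F‖ ≤ M * ∏ i, schwartzNorm s (φ i)) →
      ∀ F : 𝓢((Fin n → EuclideanSpace ℝ (Fin 4)), ℂ), IsOffDiagonal F → ‖T F‖ ≤ M * C * schwartzNorm t F := by
  obtain ⟨t, K, hK, hB⟩ := disjointLocalisedBound s
  obtain ⟨p, t', C₁, hC₁, hC⟩ := separatedScaleBound n t
  obtain ⟨C₂, t'', hC₂, hD⟩ := flatShellDecomposition n t' (p + 1)
  refine ⟨t'', K ^ n * C₁ * C₂ * (128 : ℝ) ^ p * 2, by positivity, fun T M hM hT F hF => ?_⟩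
  have hloc := hB n T M hM hT
  -- the bound on compactly supported separated tests
  have hsep : ∀ u : 𝓢((Fin n → EuclideanSpace ℝ (Fin 4)), ℂ), IsOffDiagonal u →
      HasCompactSupport (u : (Fin n → EuclideanSpace ℝ (Fin 4)) → ℂ) →
      (∃ δ : ℝ, 0 < δ ∧ ∀ x ∈ tsupport (u : (Fin n → EuclideanSpace ℝ (Fin 4)) → ℂ), ∀ i j, i ≠ j → δ ≤ ‖x i - x j‖) →
      ‖T u‖ ≤ M * (K ^ n * C₁ * C₂ * (128 : ℝ) ^ p * 2) * schwartzNorm t'' u := by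
    intro u hu huc husep
    obtain ⟨J, v, huv, hv⟩ := hD u hu huc husep
    have hterm : ∀ j, ‖T (v j)‖ ≤ M * K ^ n * C₁ * C₂ * (128 : ℝ) ^ p * (2 : ℝ)⁻¹ ^ j * schwartzNorm t'' u := by
      intro j
      obtain ⟨hvc, hvsep, hvn⟩ := hv j
      set ε : ℝ := (2 : ℝ)⁻¹ ^ (j + 1) / 64 with hε
      have hε0 : 0 < ε := by positivity
      have hε1 : ε ≤ 1 := by
        rw [hε, div_le_one (by norm_num)]
        exact (pow_le_one₀ (by norm_num) (by norm_num)).trans (by norm_num)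
      have h64 : ∀ x ∈ tsupport (v j : (Fin n → EuclideanSpace ℝ (Fin 4)) → ℂ), ∀ i i', i ≠ i' → 64 * ε ≤ ‖x i - x i'‖ := by
        intro x hx i i' hii'
        have : 64 * ε = (2 : ℝ)⁻¹ ^ (j + 1) := by rw [hε]; ring
        rw [this]
        exact hvsep x hx i i' hii'
      have h1 := hC T M K hM hK hloc ε hε0 hε1 (v j) hvc h64
      have hεinv : ε⁻¹ = 128 * (2 : ℝ) ^ j := by
        rw [hε, inv_pow, pow_succ, inv_div]
        field_simp
        norm_num
      have hεp : ε⁻¹ ^ p = (128 : ℝ) ^ p * (2 : ℝ) ^ (p * j) := by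
        rw [hεinv, mul_pow, ← pow_mul, mul_comm j p]
      calc ‖T (v j)‖ ≤ M * K ^ n * C₁ * ε⁻¹ ^ p * schwartzNorm t' (v j) := h1
        _ ≤ M * K ^ n * C₁ * ε⁻¹ ^ p * (C₂ * (2 : ℝ)⁻¹ ^ ((p + 1) * j) * schwartzNorm t'' u) := by
            gcongr
        _ = M * K ^ n * C₁ * C₂ * (128 : ℝ) ^ p * (2 : ℝ)⁻¹ ^ j * schwartzNorm t'' u := by
            rw [hεp, add_mul, one_mul, pow_add, inv_pow, inv_pow]
            field_simp
    calc ‖T u‖ = ‖∑ j ∈ Finset.range J, T (v j)‖ := by rw [huv, map_sum]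
      _ ≤ ∑ j ∈ Finset.range J, ‖T (v j)‖ := norm_sum_le _ _
      _ ≤ ∑ j ∈ Finset.range J, M * K ^ n * C₁ * C₂ * (128 : ℝ) ^ p * (2 : ℝ)⁻¹ ^ j * schwartzNorm t'' u :=
          Finset.sum_le_sum fun j _ => hterm j
      _ = M * K ^ n * C₁ * C₂ * (128 : ℝ) ^ p * (∑ j ∈ Finset.range J, (2 : ℝ)⁻¹ ^ j) * schwartzNorm t'' u := by
          rw [Finset.mul_sum, Finset.sum_mul]
      _ ≤ M * K ^ n * C₁ * C₂ * (128 : ℝ) ^ p * 2 * schwartzNorm t'' u := by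
          have hgeom : ∑ j ∈ Finset.range J, (2 : ℝ)⁻¹ ^ j ≤ 2 := by
            have := geom_sum_Ico_le_of_lt_one (x := (2 : ℝ)⁻¹) (m := 0) (n := J) (by norm_num) (by norm_num)
            simp only [pow_zero] at this
            rw [Finset.range_eq_Ico]
            refine this.trans ?_
            norm_num
          have h0 : 0 ≤ M * K ^ n * C₁ * C₂ * (128 : ℝ) ^ p := by positivity
          gcongr
          · exact schwartzNorm_nonneg _ _
      _ = M * (K ^ n * C₁ * C₂ * (128 : ℝ) ^ p * 2) * schwartzNorm t'' u := by ring
  -- density of compactly supported separated tests in `⁰𝒮`, and continuity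
  obtain ⟨u, huc, husep, hlim⟩ :=
    Summit.QuantumFields.YangMills.Cruxes.OSLegsAtWeakCouplingC.Sketch.exists_separated_tendsto_of_isOffDiagonal F hF
  have hu_off : ∀ m, IsOffDiagonal (u m) := by
    intro m
    obtain ⟨δ, hδ, hsub⟩ := husep m
    refine IsOffDiagonal.of_tsupport_subset ?_
    intro x hx hxc
    obtain ⟨i, j, hij, hxij⟩ := hxc
    have h := hsub hx i j hij
    rw [hxij, dist_self] at h
    exact absurd h (not_le.2 hδ)
  have hu_sep : ∀ m, ∃ δ : ℝ, 0 < δ ∧ ∀ x ∈ tsupport (u m : (Fin n → EuclideanSpace ℝ (Fin 4)) → ℂ),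
      ∀ i j, i ≠ j → δ ≤ ‖x i - x j‖ := by
    intro m
    obtain ⟨δ, hδ, hsub⟩ := husep m
    exact ⟨δ, hδ, fun x hx i j hij => by rw [← dist_eq_norm]; exact hsub hx i j hij⟩
  have hbound : ∀ m, ‖T (u m)‖ ≤ M * (K ^ n * C₁ * C₂ * (128 : ℝ) ^ p * 2) * schwartzNorm t'' (u m) :=
    fun m => hsep (u m) (hu_off m) (huc m) (hu_sep m)
  have hqc : Continuous fun G : 𝓢((Fin n → EuclideanSpace ℝ (Fin 4)), ℂ) => schwartzNorm t'' G :=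
    Seminorm.continuous_finsetSup (s := Finset.Iic (t'', t'')) fun i _ =>
      (schwartz_withSeminorms ℂ (Fin n → EuclideanSpace ℝ (Fin 4)) ℂ).continuous_seminorm i
  have hl : Tendsto (fun m => ‖T (u m)‖) atTop (𝓝 ‖T F‖) :=
    (continuous_norm.tendsto _).comp ((T.continuous.tendsto _).comp hlim)
  have hr : Tendsto (fun m => M * (K ^ n * C₁ * C₂ * (128 : ℝ) ^ p * 2) * schwartzNorm t'' (u m)) atTop
      (𝓝 (M * (K ^ n * C₁ * C₂ * (128 : ℝ) ^ p * 2) * schwartzNorm t'' F)) :=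
    ((hqc.tendsto _).comp hlim).const_mul _
  exact le_of_tendsto_of_tendsto' hl hr hbound


/-- **Registered sub-goal `uniformFunctionalBoundPlanes_fixedDegree` (Z1 at fixed degree)**: along a scheme with the `k`-uniform
plane-resolved `n!`-moment bounds, for every degree `n` there are an order `t` and a constant `C` with
`‖planeDist r sch k n q F‖ ≤ C |F|_t` for every string `q`, every `F ∈ ⁰𝒮ₙ` and EVERY step `k`. [folklore] -/
theorem uniformFunctionalBoundPlanes_fixedDegree :
    ∀ (G : Type) [Group G] [TopologicalSpace G] [IsTopologicalGroup G] [CompactSpace G] [MeasurableSpace G] [BorelSpace G] (r : LatticeRep G) (sch : SpeciesScheme (YMSpecies G)), UniformMomentBoundsPlanes r sch → ∀ n : ℕ, ∃ (t : ℕ) (C : ℝ), 0 ≤ C ∧ ∀ (q : Fin n → Plane) (F : 𝓢((Fin n → EuclideanSpace ℝ (Fin 4)), ℂ)), IsOffDiagonal F → ∀ k : ℕ, ‖planeDist r sch k n q F‖ ≤ C * schwartzNorm t F := by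
  intro G _ _ _ _ _ _ r sch hUMB n
  obtain ⟨s, C₀, C₁, hC₀, hC₁, hprod⟩ := planeDist_disjointProductBound G r sch hUMB
  obtain ⟨t, C, hC, hext⟩ := offDiagonal_bound_of_disjointProductBound n s
  refine ⟨t, C₀ * C₁ ^ n * (n.factorial : ℝ) * C, by positivity, fun q F hF k => ?_⟩
  have h := hext (planeDist r sch k n q) (C₀ * C₁ ^ n * (n.factorial : ℝ)) (by positivity)
    (fun φ hφ F' hF' => hprod k n q φ hφ F' hF') F hF
  simpa [mul_assoc] using h

end Summit.QuantumFields.YangMills.Cruxes.HypercubicLimit.CouplingResponse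

end
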